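import Mathlib
import HarnessLib
import Summits.Langlands.Langlands.Theses.QuarterDeficit1951
import Summits.Langlands.Langlands.Theorems.QuarterDeficit1951CorrespondentFingerprintStubSatakeSmallPrimes
import Literature.NumberTheory.Automorphic.CarayolUnramifiedOfLocalGlobalProofs
import Literature.NumberTheory.GaloisRepresentations.WeilDeligneOfGaloisUnramifiedProofs

/-!
# Helper for stub `stub_levelOne` (crux stmt-Langlands-15898 `QuarterDeficit1951.CorrespondentFingerprint`,
# line `Sketch`): sphericality of the correspondent away from `1951`

Support file (closes nothing; `--supports stmt-Langlands-15898`).  Parts (A) and (B) of the plan of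
the registered stub `stub_levelOne` (LevelExactness): for a cuspidal `π` on `GL₂(𝔸_ℚ)` and a framed
`ρ : Γ_ℚ → GL₂(ℚ̄_ℓ)` with the summit's local–global compatibility `LocalGlobalCompatibleAt RD ι π ρ v`
at a finite place `v` where `ρ` is UNRAMIFIED, `π` is unramified at `v` (`IsUnramifiedAt`: it has a
Satake parameter there, i.e. `π_v` is spherical):

* (A) `v ∤ ℓ`: this is the sibling stub file's
  `isUnramifiedAt_of_localGlobalCompatibleAt_of_isUnramifiedAt` (`…StubSatakeSmallPrimes`, imported):
  the `r` of the clause is attached to `ρ|_{W_{ℚ_v}}` by the Grothendieck–Deligne recipe, which at a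
  `ρ` trivial on inertia has `N = 0` and unramified `r.ρ`, and so do the transport `ι(r)` and its
  Frobenius-semisimplification (`FramedGaloisRep.exists_frobSemisimple_unramified_of_isUnramifiedAt`);
  then `L(s, π_v × 1)` has degree `2` (`hasRSLFactor_of_recGL_unramified`, `π_v` generic as a
  cuspidal local component), `π_v` is spherical
  (`exists_mem_fixedPoints_glInt_of_hasRSLFactor_natDegree_two`, Jacquet–Langlands) and the
  Borel–Jacquet dictionary (`isUnramifiedAt_of_hasLocalComponentAt_of_mem_fixedPoints`) concludes —
  the common tail `isUnramifiedAt_of_recGL_eq_unramified` below.  No finite-image hypothesis.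
* (B) `v ∣ ℓ` (`isUnramifiedAt_of_localGlobalCompatibleAt_above`): the clause attaches `r` to
  `ρ|_{Γ_{ℚ_v}}` through Fontaine's PINNED datum `RD.pst ℓ v hv`, whose structure field
  `PstWeilDeligneData.wd_of_isLocallyUnramified` gives `r.N = 0` and unramified `r.ρ` for a locally
  unramified `ρ` — no Frobenius eigenvalue and no `FontaineDatumExists` is used; then the same chain.
* `isUnramifiedAt_of_localGlobalCompatibleAt`, `isUnramifiedAt_of_corresponds` — both cases together;
  `isUnramifiedAt_of_corresponds_of_residueCard_ne` — the form consumed by the crux: under its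
  hypotheses (`ρ` unramified at every `v` with `q_v ≠ 1951`), `π` is unramified at every such `v`;
  `stub_levelOne_spherical` — the registered closed form (sub-goal of `stub_levelOne`).

No definitions; standard axioms; no named fact is assumed.
-/

set_option linter.dupNamespace false -- project-wide option (lakefile weak.linter.dupNamespace); `Summit.Langlands.Langlands` is the mandated namespace

noncomputable section

open scoped MatrixGroups Matrix NumberField Classical Polynomial
open Literature.NumberTheory.Automorphic Literature.NumberTheory.GaloisRepresentations
  IsDedekindDomain NumberField Polynomial MeasureTheory
open Summit.Langlands

namespace Summit.Langlands.Langlands.Theorems.CorrespondentFingerprint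

variable {K : Type} [Field K] [NumberField K] {ℓ : ℕ} [Fact ℓ.Prime]
  {hcpt : isCompact_glFiniteIntegralLevel 2 K}

/-- **The common tail: an unramified parameter makes `π` unramified.**  If a cuspidal `π` on
`GL₂(𝔸_K)` has an irreducible smooth local component `π_v` at `v` whose class `rec_v(π_v)` under a
local Langlands datum `d` is `⟦r'⟧` for a Frobenius-semisimple `r'` with `r'.N = 0` and `r'.ρ`
trivial on inertia, then `π` is unramified at `v`: `π_v` is generic
(`exists_isGeneric_of_hasLocalComponentAt`), `L(s, π_v × 1)` has degree `2` for every invariant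
measure (`hasRSLFactor_of_recGL_unramified`), so `π_v` is spherical
(`exists_mem_fixedPoints_glInt_of_hasRSLFactor_natDegree_two`) and the Borel–Jacquet dictionary
applies (`isUnramifiedAt_of_hasLocalComponentAt_of_mem_fixedPoints`).
[cite: JacquetLanglands1970, Prop. 3.5, Thm. 2.18] [cite: FlathCorvallis1979, Thm. 3] -/
theorem isUnramifiedAt_of_recGL_eq_unramified (π : CuspidalAutomorphicRepData 2 K hcpt)
    (v : HeightOneSpectrum (𝓞 K)) (d : LocalLanglandsDatum (v.adicCompletion K))
    (πv : SmoothIrrep (GL (Fin 2) (v.adicCompletion K))) (hloc : π.1.HasLocalComponentAt v πv.ρ)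
    (r' : WeilDeligneRep (v.adicCompletion K) ℂ (Fin 2 → ℂ)) (hr' : r'.IsFrobSemisimple)
    (hq : d.recGL 2 (IrrClass.mk πv) =
      Quotient.mk (frobSemisimpleWDSetoid (v.adicCompletion K) 2) ⟨r', hr'⟩)
    (hN : r'.N = 0) (hur : WeilGroup.IsUnramifiedRep r'.ρ) : π.1.IsUnramifiedAt v := by
  classical
  haveI := πv.isIrreducible
  obtain ⟨ψ, hψ, hgen⟩ := π.exists_isGeneric_of_hasLocalComponentAt v πv.ρ πv.isSmooth hloc
  haveI : CharZero (v.adicCompletion K) :=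
    charZero_of_injective_algebraMap (algebraMap K (v.adicCompletion K)).injective
  obtain ⟨x, hx0, hxK⟩ := exists_mem_fixedPoints_glInt_of_hasRSLFactor_natDegree_two πv ψ hψ
    (fun ν _ _ _ => hasRSLFactor_of_recGL_unramified d πv r' hr' hq hN hur ψ hψ hgen ν)
  rw [glInt_adicCompletion_eq] at hxK
  exact π.1.isUnramifiedAt_of_hasLocalComponentAt_of_mem_fixedPoints v πv hloc hx0 hxK

omit [NumberField K] in
/-- A representation of `Γ_K` unramified at `v` restricts to a locally unramified representation
of `Γ_{K_v}` (it kills `I_{K_v}`, `FramedGaloisRep.toLocal_eq_one_of_mem_absInertia`).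
[cite: SerreLocalFields1979, Ch. VI §2] -/
theorem isLocallyUnramified_toLocal [NumberField K] {n : ℕ} (ρ : FramedGaloisRep K (PadicAlgCl ℓ) n)
    {v : HeightOneSpectrum (𝓞 K)} (hρ : ρ.IsUnramifiedAt v) : (ρ.toLocal v).IsLocallyUnramified :=
  fun _ hσ => ρ.toLocal_eq_one_of_mem_absInertia hρ hσ

/-- **(B) `v ∣ ℓ`: local–global compatibility above `ℓ` at a place where `ρ` is unramified makes
`π` unramified there.**  The clause attaches `r` to `ρ|_{Γ_{K_v}}` through the PINNED Fontaine
datum `RD.pst ℓ v hv`; its structure field `wd_of_isLocallyUnramified` gives `r.N = 0` and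
unramified `r.ρ` for the locally unramified `ρ|_{Γ_{K_v}}` (unramified ⇒ crystalline, inertia
acts trivially on `WD ∘ D_pst`), and these pass to the transport and to its
Frobenius-semisimplification (`IsTransportAlong.N_eq_zero`, `….isUnramifiedRep`,
`HasFrobSemisimpleClass.exists_of_isUnramifiedRep`); conclude by
`isUnramifiedAt_of_recGL_eq_unramified`.  No Frobenius eigenvalue and no `FontaineDatumExists`.
[cite: FontaineAsterisque223VIII, §1.3 and §2.3.7] [cite: TateCorvallis1979, (4.1.3)] -/
theorem isUnramifiedAt_of_localGlobalCompatibleAt_above (RD : ReciprocityData K)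
    (ι : PadicAlgCl ℓ ≃+* ℂ) (π : CuspidalAutomorphicRepData 2 K hcpt)
    (ρ : FramedGaloisRep K (PadicAlgCl ℓ) 2) (v : HeightOneSpectrum (𝓞 K))
    (hv : ((ℓ : ℕ) : 𝓞 K) ∈ v.asIdeal) (hρ : ρ.IsUnramifiedAt v)
    (hLG : LocalGlobalCompatibleAt RD ι π.1 ρ v) : π.1.IsUnramifiedAt v := by
  obtain ⟨πv, rv, rℂ, hloc, -, hpst, hTr, hcl⟩ := hLG
  obtain ⟨hN, hur⟩ :=
    (RD.pst ℓ v hv).wd_of_isLocallyUnramified (ρ.toLocal v) rv (isLocallyUnramified_toLocal ρ hρ)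
      (hpst hv)
  obtain ⟨r', hr', h1, h2, h3⟩ :=
    hcl.exists_of_isUnramifiedRep (hTr.N_eq_zero hN) (hTr.isUnramifiedRep hur)
  exact isUnramifiedAt_of_recGL_eq_unramified π v (RD.llc v) πv hloc r' hr' h1.symm h2 h3

/-- **Local–global compatibility at ANY finite place where `ρ` is unramified makes `π` unramified
there** ((A) at `v ∤ ℓ`, (B) at `v ∣ ℓ`). [cite: TateCorvallis1979, (4.1.3)–(4.2.1)]
[cite: FontaineAsterisque223VIII, §2.3.7] -/
theorem isUnramifiedAt_of_localGlobalCompatibleAt (RD : ReciprocityData K)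
    (ι : PadicAlgCl ℓ ≃+* ℂ) (π : CuspidalAutomorphicRepData 2 K hcpt)
    (ρ : FramedGaloisRep K (PadicAlgCl ℓ) 2) (v : HeightOneSpectrum (𝓞 K))
    (hρ : ρ.IsUnramifiedAt v) (hLG : LocalGlobalCompatibleAt RD ι π.1 ρ v) :
    π.1.IsUnramifiedAt v := by
  by_cases hv : ((ℓ : ℕ) : 𝓞 K) ∈ v.asIdeal
  · exact isUnramifiedAt_of_localGlobalCompatibleAt_above RD ι π ρ v hv hρ hLG
  · exact isUnramifiedAt_of_localGlobalCompatibleAt_of_isUnramifiedAt RD ι π ρ v hv hρ hLG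

/-- **A correspondent of `ρ` is unramified wherever `ρ` is** (`Corresponds` contains local–global
compatibility at every finite place). [cite: TateCorvallis1979, (4.1.3)–(4.2.1)]
[cite: HarrisTaylorAMS2001, Thm. A] -/
theorem isUnramifiedAt_of_corresponds (RD : ReciprocityData K) (ι : PadicAlgCl ℓ ≃+* ℂ)
    (π : CuspidalAutomorphicRepData 2 K hcpt) (ρ : FramedGaloisRep K (PadicAlgCl ℓ) 2)
    (hcorr : Corresponds RD ι π.1 ρ) (v : HeightOneSpectrum (𝓞 K)) (hρ : ρ.IsUnramifiedAt v) :
    π.1.IsUnramifiedAt v :=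
  isUnramifiedAt_of_localGlobalCompatibleAt RD ι π ρ v hρ (hcorr.2 v)

/-- **The form consumed by `stub_levelOne`**: under the hypotheses of the crux
`CorrespondentFingerprint` (the correspondent `π` of a `ρ` unramified at every finite `v` with
`q_v ≠ 1951`), `π` is unramified — `π_v` is spherical — at every finite place `v` of `ℚ` with
`q_v ≠ 1951`, including the place above `ℓ`. [cite: TateCorvallis1979, (4.1.3)–(4.2.1)]
[cite: FontaineAsterisque223VIII, §2.3.7] -/
theorem isUnramifiedAt_of_corresponds_of_residueCard_ne {hcpt : isCompact_glFiniteIntegralLevel 2 ℚ}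
    (RD : ReciprocityData ℚ) (ι : PadicAlgCl ℓ ≃+* ℂ) (π : CuspidalAutomorphicRepData 2 ℚ hcpt)
    (ρ : FramedGaloisRep ℚ (PadicAlgCl ℓ) 2)
    (hunr : ∀ v : HeightOneSpectrum (𝓞 ℚ), v.residueCard ≠ 1951 → ρ.IsUnramifiedAt v)
    (hcorr : Corresponds RD ι π.1 ρ) (v : HeightOneSpectrum (𝓞 ℚ)) (hv : v.residueCard ≠ 1951) :
    π.1.IsUnramifiedAt v :=
  isUnramifiedAt_of_corresponds RD ι π ρ hcorr v (hunr v hv)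

/-- **Registered sub-goal `stub_levelOne_spherical` of `stub_levelOne`** (closed form of
`isUnramifiedAt_of_localGlobalCompatibleAt`): for a cuspidal `π` on `GL₂(𝔸_K)`, a framed
`ρ : Γ_K → GL₂(ℚ̄_ℓ)`, any reciprocity data and any finite place `v` (above `ℓ` or not) at which `ρ`
is unramified, the summit's local–global compatibility at `v` forces `π` to be unramified at `v`.
[cite: TateCorvallis1979, (4.1.3)–(4.2.1)] [cite: FontaineAsterisque223VIII, §2.3.7]
[cite: JacquetLanglands1970, Prop. 3.5, Thm. 2.18] -/
theorem stub_levelOne_spherical : ∀ (K : Type) [Field K] [NumberField K] (ℓ : ℕ) [Fact ℓ.Prime]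
    (hcpt : isCompact_glFiniteIntegralLevel 2 K) (RD : Summit.Langlands.ReciprocityData K)
    (ι : PadicAlgCl ℓ ≃+* ℂ) (π : CuspidalAutomorphicRepData 2 K hcpt)
    (ρ : FramedGaloisRep K (PadicAlgCl ℓ) 2) (v : HeightOneSpectrum (𝓞 K)),
    ρ.IsUnramifiedAt v → Summit.Langlands.LocalGlobalCompatibleAt RD ι π.1 ρ v →
    π.1.IsUnramifiedAt v :=
  fun _ _ _ _ _ _ RD ι π ρ v hρ hLG => isUnramifiedAt_of_localGlobalCompatibleAt RD ι π ρ v hρ hLG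

end Summit.Langlands.Langlands.Theorems.CorrespondentFingerprint

end
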